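import Mathlib
import HarnessLib
import Summits.HubbardSuperconductivity.HubbardSuperconductivity.Theorems.KLProgrammeKLRegimeEngineTowerBlockIncrLevKit
import Summits.HubbardSuperconductivity.HubbardSuperconductivity.Theorems.KLProgrammeKLRegimeEngineTowerDoorToKitGraded
import Summits.HubbardSuperconductivity.HubbardSuperconductivity.Theorems.KLProgrammeKLRegimeEngineTowerBlockIncrLevKitUnits
import Summits.HubbardSuperconductivity.HubbardSuperconductivity.Theorems.KLProgrammeKLRegimeEngineTowerLevBridgeSucc

/-!
# Route `KLProgramme` — crux K3 ENGINE (stmt-HubbardSuperconductivity-20437 `KLRegimeEngineV17F2`), stub (b) v2, THE LEVELS PACKAGE (ℓ):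
# instantiation (I1), «(I1)-LEV-GRADED-UNITS» ∘ «(I1)-LEV-PIN-CREDIT» — the graded levelled `hstep` with the input read at level `c + 1` (pin credited)
# (located by p4 g18, 2026-08-28: the `_graded` rows of …TowerBlockIncrLevKitGraded read the input through …TowerLevBridge's `E.erase q` bridge, one half-power short;
#  this file is their twin over …TowerLevBridgeSucc; cell gate-hubbard-kl, seat hubbard-kl-k3c2-p3 g12 as SUBSTITUTE typer — E1 may rename or supersede)

Same compositions as …TowerBlockIncrLevKitGraded (p651584/p651834) with ONE change: the doors' input sizes are `B m Fc := klTowerMeasLev … d k (2m) (Fc + 1)`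
(`doorInput_klTowerInput_le_klTowerMeasLev_succ`: the pinned leg's own label is a known leg), so the graded majorant reads
  **`hNB : 27^c·ε·klTowerMeasLev … d k (2m) (c + 1) ≤ ω c·N m`** — level count `c + 1` on the left, credit `ω c` on the right: the SAME convention
(`F = levelCount`, credit `ω(F − 1)`) as the output side `klTowerBornLev … F ≤ ω(F − 1)·…`, hence dischargeable k-uniformly by the levelled law (UNITS-MAP §(1):
`27^{c+1}·MeasLev(2m, c+1) = μ_c·klLevUnit c m J`, `klLevUnit ∝ ω c`).  Rows: `klLevNormOf_klTowerIncr_le_kit_graded_succ_succ`, `klTowerBornLev_le_kit_graded_succ_succ`,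
`klTowerBornLev_le_kit_graded_succ_succ'` (literal kit shape), `klTowerBornLev_le_kit_graded_succ_succ_units` (÷(u, Kc)).  The `_graded` rows stay true (weaker input convention).
Compositions of landed theorems; nothing about the model is asserted beyond them; nothing asserts (ℓ), any stub, K3 or superconductivity.
References: BGM 2006 §2.8 (2.76)–(2.84), (2.88)–(2.90), §3 (3.2)–(3.8), Lemma 2.5 (2.98) [cite: BenfattoGiulianiMastropietro2006].
-/

noncomputable section

namespace Summit.HubbardSuperconductivity.HubbardSuperconductivity.Theorems.EngineV8

set_option linter.dupNamespace false -- summit = problem name (single-conjunct summit), D-0017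

open Classical
open Real Finset Literature.MathematicalPhysics.QuantumLattice Literature.Probability.LatticeModels GrassmannAlgebra
open Literature.MathematicalPhysics.QuantumLattice.FermiRG
open Summit.HubbardSuperconductivity.HubbardSuperconductivity.Theorems.KLProgrammeLegKernels
open Summit.HubbardSuperconductivity.HubbardSuperconductivity.Theorems.KLRegimeSplit
open Summit.HubbardSuperconductivity.HubbardSuperconductivity.Theorems.KLRegimeWick
open Summit.HubbardSuperconductivity.HubbardSuperconductivity.Theorems.TwoPointAssembly
open Summit.HubbardSuperconductivity.HubbardSuperconductivity.Theorems.DispersionFlow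
open scoped Nat

variable {L M : ℕ} [NeZero L] [NeZero M]

/-! ## §1 Every levelled norm of `Δ_k` in kit form, output units, pin credited -/

/-- **EVERY LEVELLED NORM OF A BLOCK INCREMENT IN KIT FORM, IN THE OUTPUT TRACK's UNITS** («(I1)-LEV-GRADED-UNITS», model side; see the module docstring). -/
theorem klLevNormOf_klTowerIncr_le_kit_graded_succ {β : ℝ} (hβ : 0 < β) (U μ : ℝ) (K : TrigPolyC4v) {d k J' : ℕ} (hd : 1 ≤ d) (hk : 1 ≤ k) (hJ' : d * k ≤ J')
    (hZ : hubbardEffPartitionFnCT L M β U μ 0 K (klScale klE0 (d * k)) ≠ 0)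
    {κ : ℝ} (hκ : 0 < κ)
    (hGB : IsGramBoundedR ((sectorSubMatrix L M β (bgmFatMultiplier L M klE0 β (nambuXiCT L μ K) (d * k - 1))).transpose *
      hubbardCovSliceCT L M β μ 0 K (klScale klE0 (d * (k + 1))) (klScale klE0 (d * k)) *
        sectorSubMatrix L M β (bgmFatMultiplier L M klE0 β (nambuXiCT L μ K) (d * k - 1))) κ)
    {α : ℝ} (hα : 0 < α)
    (hrow : ∀ X, ∑ Y, ‖((sectorSubMatrix L M β (bgmFatMultiplier L M klE0 β (nambuXiCT L μ K) (d * k - 1))).transpose *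
        hubbardCovSliceCT L M β μ 0 K (klScale klE0 (d * (k + 1))) (klScale klE0 (d * k)) *
          sectorSubMatrix L M β (bgmFatMultiplier L M klE0 β (nambuXiCT L μ K) (d * k - 1))) X Y‖ ≤ α)
    (hcol : ∀ Y, ∑ X, ‖((sectorSubMatrix L M β (bgmFatMultiplier L M klE0 β (nambuXiCT L μ K) (d * k - 1))).transpose *
        hubbardCovSliceCT L M β μ 0 K (klScale klE0 (d * (k + 1))) (klScale klE0 (d * k)) *
          sectorSubMatrix L M β (bgmFatMultiplier L M klE0 β (nambuXiCT L μ K) (d * k - 1))) X Y‖ ≤ α)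
    {ρ : ℝ} (hρ : 0 < ρ)
    {cr cc : ℝ} (hcr0 : 0 ≤ cr) (hcc0 : 0 ≤ cc)
    (hrow' : ∀ X'', ∑ X', ‖(sectorAnalysisMatrix L M β (klAnisoFamily L M β μ K klE0 J') *
        sectorSubMatrix L M β (bgmFatMultiplier L M klE0 β (nambuXiCT L μ K) (d * k - 1))) X'' X'‖ ≤ cr)
    (hcol' : ∀ X', ∑ X'', ‖(sectorAnalysisMatrix L M β (klAnisoFamily L M β μ K klE0 J') *
        sectorSubMatrix L M β (bgmFatMultiplier L M klE0 β (nambuXiCT L μ K) (d * k - 1))) X'' X'‖ ≤ cc)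
    {N : ℕ → ℝ} (hN0 : ∀ m, 0 ≤ N m) (hN00 : N 0 = 0)
    {ω : ℕ → ℝ} (hω0 : ∀ c, 0 ≤ ω c) (hω1 : ω 0 ≤ 1) (hωmul : ∀ a b, ω a * ω b ≤ ω (a + b)) (hωanti : ∀ c, ω (c + 1) ≤ ω c)
    (hNB : ∀ m c, (27 : ℝ) ^ c * (imagTimeWeight β M * klTowerMeasLev L M β U μ K d k (2 * m) (c + 1)) ≤ ω c * N m)
    {D : ℕ} (hD : Fintype.card (SpaceTimeIdx L M × SectorLeg (sectorCount (d * k - 1))) / 2 ≤ D)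
    (q : ℕ) {Nk : ℕ} (hNk : 1 ≤ Nk) {Kt : ℕ} (hKt : (1 / 2 : ℝ) ^ Kt ≤ ω (2 * q + 1))
    {τ ψ : ℝ} (hτ1 : (exp 3 * κ) ^ 2 ≤ τ) (hτ2 : (exp 2 * (κ + ρ)) ^ 2 ≤ τ) (hψ1 : κ⁻¹ ^ 2 ≤ ψ) (hψ2 : ρ⁻¹ ^ 2 ≤ ψ)
    (hguard2 : 2 * (exp 1 * α / κ ^ 2) * towerV D τ N < 1) (Ωe : Fin (2 * q + 1 + 1) → Option (SectorLeg (sectorCount J'))) :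
    klLevNormOf L M β μ K J' (2 * q + 1 + 1) (klTowerIncr L M β U μ K d k) Ωe ≤
      ω (levelCount Ωe - 1) * (imagTimeWeight β M ^ (2 * q + 1) *
        (cr * cc ^ (2 * q + 1) *
            (∑ n ∈ Icc 2 Nk, exp 1 * (2 * (exp 1 * α / κ ^ 2)) ^ (n - 1) * ψ ^ (q + 1) * towerS D τ N n (q + 1) +
              ψ ^ (q + 1) * (exp 1 * towerV D τ N * (2 * (exp 1 * α / κ ^ 2) * towerV D τ N) ^ Nk /
                (1 - 2 * (exp 1 * α / κ ^ 2) * towerV D τ N))) +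
          cr * cc ^ (2 * q + 1) * (exp 2 ^ (q + 2) / 2 * towerFO D (κ ^ 2) N (q + 1)))) := by
  have hβ' : β ≠ 0 := hβ.ne'
  have hJ₁ : 1 ≤ d * k := le_trans hd (Nat.le_mul_of_pos_right d hk)
  have hJ : d * k ≤ d * (k + 1) := Nat.mul_le_mul_left d (Nat.le_succ k)
  have hε : 0 ≤ imagTimeWeight β M := imagTimeWeight_nonneg hβ.le M
  have h27 : (0 : ℝ) ≤ 27 := by norm_num
  have hG : klTowerInput L M β U μ K d k ∈ evenPart ℂ (HubbardFieldIdx L M) := klEffectiveAction_mem_evenPart hβ' U μ K klE0 (d * k)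
  have hG0 : constPart ℂ (klTowerInput L M β U μ K d k) = 0 := constPart_klEffectiveAction_eq_zero β U μ K klE0 (d * k) hZ
  -- abbreviations for the kit terms and their signs
  set Φ := exp 1 * α / κ ^ 2 with hΦ
  set FO := towerFO D (κ ^ 2) N (q + 1) with hFO
  set S := ∑ n ∈ Icc 2 Nk, exp 1 * (2 * Φ) ^ (n - 1) * ψ ^ (q + 1) * towerS D τ N n (q + 1) with hS
  set T := ψ ^ (q + 1) * (exp 1 * towerV D τ N * (2 * Φ * towerV D τ N) ^ Nk / (1 - 2 * Φ * towerV D τ N)) with hT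
  set w := ω (levelCount Ωe - 1) with hw
  have hτ0 : 0 ≤ τ := le_trans (by positivity) hτ1
  have hψ0 : 0 ≤ ψ := le_trans (by positivity) hψ1
  have hΦ0 : 0 ≤ Φ := by rw [hΦ]; positivity
  have hV0 : 0 ≤ towerV D τ N := towerV_nonneg hτ0 hN0
  have hguard : Φ * towerV D τ N < 1 := by nlinarith [mul_nonneg hΦ0 hV0]
  have hFO0 : 0 ≤ FO := towerFO_nonneg (by positivity) hN0 _
  have hS0 : 0 ≤ S := sum_nonneg fun n _ => by
    have := towerS_nonneg (D := D) hτ0 hN0 n (q + 1); positivity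
  have hT0 : 0 ≤ T := by
    refine mul_nonneg (pow_nonneg hψ0 _) (div_nonneg (by positivity) (sub_nonneg.2 ?_))
    rw [hΦ]; linarith
  have hw0 : 0 ≤ w := hω0 _
  have hωA : Antitone ω := antitone_nat_of_succ_le hωanti
  have hC0 : 0 ≤ w * (imagTimeWeight β M ^ (2 * q + 1) * (cr * cc ^ (2 * q + 1) * (S + T) + cr * cc ^ (2 * q + 1) * (exp 2 ^ (q + 2) / 2 * FO))) := by
    positivity
  -- the input sizes: measured levelled arrays
  set B : ℕ → ℕ → ℝ := fun m c => klTowerMeasLev L M β U μ K d k (2 * m) (c + 1) with hB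
  have hB0 : ∀ m c, 0 ≤ B m c := fun m c => klTowerMeasLev_nonneg hβ.le U μ K d k _ (c + 1)
  have hBin : ∀ (m' Fc : ℕ) (E : Finset (Fin (2 * m' + 1 + 1))) (τ' : Fin (2 * m' + 1 + 1) → SectorLeg (sectorCount (d * k - 1)))
      (q' : Fin (2 * m' + 1 + 1)), q' ∈ E → E.card = Fc + 1 → ∀ y : SpaceTimeIdx L M,
        imagTimeWeight β M ^ (2 * m' + 1) *
          ∑ σ ∈ univ.filter (fun σ : Fin (2 * m' + 1 + 1) → SectorLeg (sectorCount (d * k - 1)) => ∀ e ∈ E, σ e = τ' e),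
            ∑ x ∈ univ.filter (fun x : Fin (2 * m' + 1 + 1) → SpaceTimeIdx L M => x q' = y),
              ‖sectorisedKernel L M β (klAnisoFamily L M β μ K klE0 (d * k - 1)) (klTowerInput L M β U μ K d k) (2 * m' + 1 + 1) σ x‖ ≤ B (m' + 1) Fc :=
    fun m' Fc E τ' q' hq hE y => doorInput_klTowerInput_le_klTowerMeasLev_succ hβ.le U μ K d k m' Fc E τ' q' hq hE y
  have hNB' : ∀ m c, (27 : ℝ) ^ c * (imagTimeWeight β M * B m c) ≤ ω c * N m := fun m c => hNB m c
  have hNB0 : ∀ m, (27 : ℝ) ^ 0 * (imagTimeWeight β M * B m 0) ≤ N m := fun m =>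
    (hNB' m 0).trans ((mul_le_mul_of_nonneg_right hω1 (hN0 _)).trans_eq (one_mul _))
  -- the door guard from the kit guard
  have hV : normV (SpaceTimeIdx L M × SectorLeg (sectorCount (d * k - 1))) κ ρ (fun m' => (27 : ℝ) ^ 0 * (imagTimeWeight β M * B m' 0)) ≤
      towerV D τ N :=
    (normV_mono hκ.le hρ.le hNB0).trans ((normV_le_towerV hκ.le hρ.le hN0 hN00 hD).trans (towerV_mono (by positivity) hτ2 hN0 fun _ => le_rfl))
  have hθ : Real.exp 1 * α * normV (SpaceTimeIdx L M × SectorLeg (sectorCount (d * k - 1))) κ ρ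
      (fun m' => (27 : ℝ) ^ 0 * (imagTimeWeight β M * B m' 0)) / κ ^ 2 < 1 := by
    calc Real.exp 1 * α * normV (SpaceTimeIdx L M × SectorLeg (sectorCount (d * k - 1))) κ ρ
          (fun m' => (27 : ℝ) ^ 0 * (imagTimeWeight β M * B m' 0)) / κ ^ 2
        = Φ * normV (SpaceTimeIdx L M × SectorLeg (sectorCount (d * k - 1))) κ ρ (fun m' => (27 : ℝ) ^ 0 * (imagTimeWeight β M * B m' 0)) := by
          rw [hΦ]; ring
      _ ≤ Φ * towerV D τ N := mul_le_mul_of_nonneg_left hV hΦ0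
      _ < 1 := hguard
  -- the output bridge: every door-form sum is bounded by the kit right side
  refine klLevNormOf_le_of_forall_doorSum_le hβ.le μ K J' (klTowerIncr L M β U μ K d k) Ωe hC0 fun p s x => ?_
  set J : Finset (Fin (2 * q + 1 + 1)) := univ.filter (fun i : Fin (2 * q + 1 + 1) => (Ωe i).isSome ∧ i ≠ p) with hJdef
  have hp : p ∉ J := by rw [hJdef, mem_filter]; exact fun h => h.2.2 rfl
  -- the output's known legs besides the pin: `|J| ≥ levelCount Ωe − 1` and `|J| ≤ 2q+1`, so `(1/2)^Kt ≤ ω(2q+1) ≤ ω |J| ≤ ω(levelCount Ωe − 1)`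
  have hJeq : J = (univ.filter fun i : Fin (2 * q + 1 + 1) => (Ωe i).isSome).erase p := by
    rw [hJdef]; ext i; simp only [mem_filter, mem_univ, true_and, mem_erase]; tauto
  have hJge : levelCount Ωe - 1 ≤ J.card := by rw [hJeq, levelCount]; exact pred_card_le_card_erase
  have hJle : J.card ≤ 2 * q + 1 := by
    have h := card_le_card (show J ⊆ univ.erase p from fun i hi => mem_erase.2 ⟨fun h => hp (h ▸ hi), mem_univ _⟩)
    rwa [card_erase_of_mem (mem_univ _), card_univ, Fintype.card_fin, Nat.add_sub_cancel] at h
  have hωJ : ω J.card ≤ w := hωA hJge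
  have hKJ : (1 / 2 : ℝ) ^ Kt ≤ ω J.card := hKt.trans (hωA hJle)
  have hN₀ : 2 ≤ Nk + Kt + 1 := by omega
  -- the two doors at this (p, J, τ″, w″), the graded one at truncation `Nk + Kt + 1`
  have h2 := blockStep_ordersGe2_lev_le (L := L) (M := M) hβ μ K hJ₁ hJ hJ' (klTowerInput L M β U μ K d k) hG hG0 hκ hGB B hB0 hBin hα hrow hcol
    hρ hθ hcc0 hrow' hcol' hN₀ (m := 2 * q + 1) p J hp (fun j => (Ωe j).getD s) (x, s)
  have h1 := blockStep_firstOrder_lev_le (L := L) (M := M) hβ μ K hJ₁ hJ hJ' (klTowerInput L M β U μ K d k) hG hκ.le hGB B hB0 hBin hcc0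
    hrow' hcol' (q := q) p J hp (fun j => (Ωe j).getD s) (x, s)
  -- dominate the brackets by the kit terms IN THE OUTPUT'S UNITS, then `ω |J| ≤ ω(levelCount Ωe − 1)`
  have hKJ' : (1 / 2 : ℝ) ^ Kt ≤ ω (Fintype.card ↥J) := by rwa [Fintype.card_coe]
  have hgr := doorGradedPrescribed_le_kitStep_graded (Γ := SpaceTimeIdx L M × SectorLeg (sectorCount (d * k - 1))) (Jt := ↥J)
    hκ hρ hα.le h27 hε hB0 hN0 hN00 hω0 hω1 hωmul hNB' hD hNk hKJ' (m := 2 * q + 1) (p := q + 1) (by ring) hτ1 hτ2 hψ1 hψ2 hguard2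
  rw [Fintype.card_coe] at hgr
  have hfo := doorBinomialPrescribedJ_le_towerFO_graded (κ := κ) (ρc := (27 : ℝ)) (ε := imagTimeWeight β M) hκ.le h27 hε hB0 (N := N) hN0 hω0 hNB' hD q J
  have hgr' := hgr.trans (mul_le_mul_of_nonneg_right hωJ (add_nonneg hS0 hT0))
  have hfo' := hfo.trans (mul_le_mul_of_nonneg_right hωJ (by positivity))
  have h2' := h2.trans (mul_le_mul_of_nonneg_left hgr' (by positivity))
  have h1' := h1.trans (mul_le_mul_of_nonneg_left hfo' (by positivity))
  -- split `Δ_k` inside the door-form sum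
  rw [klTowerIncr_eq_ordersGe2_add_firstOrder β U μ K d k hZ, map_add]
  have hsplit : ∀ X : Fin (2 * q + 1 + 1) → SpaceTimeIdx L M × SectorLeg (sectorCount J'),
      ‖kernel ℂ (ExteriorAlgebra.map (Matrix.toLin' (sectorAnalysisMatrix L M β (klAnisoFamily L M β μ K klE0 J')))
            (effAction ℂ (hubbardCovSliceCT L M β μ 0 K (klScale klE0 (d * (k + 1))) (klScale klE0 (d * k))) (klTowerInput L M β U μ K d k) -
              gaussConv ℂ (hubbardCovSliceCT L M β μ 0 K (klScale klE0 (d * (k + 1))) (klScale klE0 (d * k))) (klTowerInput L M β U μ K d k)) +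
          ExteriorAlgebra.map (Matrix.toLin' (sectorAnalysisMatrix L M β (klAnisoFamily L M β μ K klE0 J')))
            (gaussConv ℂ (hubbardCovSliceCT L M β μ 0 K (klScale klE0 (d * (k + 1))) (klScale klE0 (d * k))) (klTowerInput L M β U μ K d k) -
              klTowerInput L M β U μ K d k)) (2 * q + 1 + 1) X‖ ≤
        ‖kernel ℂ (ExteriorAlgebra.map (Matrix.toLin' (sectorAnalysisMatrix L M β (klAnisoFamily L M β μ K klE0 J')))
            (effAction ℂ (hubbardCovSliceCT L M β μ 0 K (klScale klE0 (d * (k + 1))) (klScale klE0 (d * k))) (klTowerInput L M β U μ K d k) -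
              gaussConv ℂ (hubbardCovSliceCT L M β μ 0 K (klScale klE0 (d * (k + 1))) (klScale klE0 (d * k))) (klTowerInput L M β U μ K d k)))
            (2 * q + 1 + 1) X‖ +
        ‖kernel ℂ (ExteriorAlgebra.map (Matrix.toLin' (sectorAnalysisMatrix L M β (klAnisoFamily L M β μ K klE0 J')))
            (gaussConv ℂ (hubbardCovSliceCT L M β μ 0 K (klScale klE0 (d * (k + 1))) (klScale klE0 (d * k))) (klTowerInput L M β U μ K d k) -
              klTowerInput L M β U μ K d k)) (2 * q + 1 + 1) X‖ := fun X => by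
    rw [kernel_add]; exact norm_add_le _ _
  calc imagTimeWeight β M ^ (2 * q + 1) * _
      ≤ imagTimeWeight β M ^ (2 * q + 1) * (_ + _) := by
        refine mul_le_mul_of_nonneg_left ((sum_le_sum fun X _ => hsplit X).trans (le_of_eq (sum_add_distrib))) (pow_nonneg hε _)
    _ ≤ imagTimeWeight β M ^ (2 * q + 1) * (cr * cc ^ (2 * q + 1) * (w * (S + T)) + cr * cc ^ (2 * q + 1) * (w * (exp 2 ^ (q + 2) / 2 * FO))) :=
        mul_le_mul_of_nonneg_left (add_le_add h2' h1') (pow_nonneg hε _)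
    _ = w * (imagTimeWeight β M ^ (2 * q + 1) * (cr * cc ^ (2 * q + 1) * (S + T) + cr * cc ^ (2 * q + 1) * (exp 2 ^ (q + 2) / 2 * FO))) := by
        ring


/-! ## §2 The born levelled arrays in kit form, output units -/

/-- **THE BORN LEVELLED ARRAYS OF A BLOCK INCREMENT IN KIT FORM, IN THEIR OWN TRACK's UNITS**: at the born family `J′ = dk`, level count `F` gains `ω(F − 1)`
(the graded `hstep` row of the levelled tracks; `ciSup`; an empty level gives `0 ≤` the same). -/
theorem klTowerBornLev_le_kit_graded_succ {β : ℝ} (hβ : 0 < β) (U μ : ℝ) (K : TrigPolyC4v) {d k : ℕ} (hd : 1 ≤ d) (hk : 1 ≤ k)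
    (hZ : hubbardEffPartitionFnCT L M β U μ 0 K (klScale klE0 (d * k)) ≠ 0)
    {κ : ℝ} (hκ : 0 < κ)
    (hGB : IsGramBoundedR ((sectorSubMatrix L M β (bgmFatMultiplier L M klE0 β (nambuXiCT L μ K) (d * k - 1))).transpose *
      hubbardCovSliceCT L M β μ 0 K (klScale klE0 (d * (k + 1))) (klScale klE0 (d * k)) *
        sectorSubMatrix L M β (bgmFatMultiplier L M klE0 β (nambuXiCT L μ K) (d * k - 1))) κ)
    {α : ℝ} (hα : 0 < α)
    (hrow : ∀ X, ∑ Y, ‖((sectorSubMatrix L M β (bgmFatMultiplier L M klE0 β (nambuXiCT L μ K) (d * k - 1))).transpose *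
        hubbardCovSliceCT L M β μ 0 K (klScale klE0 (d * (k + 1))) (klScale klE0 (d * k)) *
          sectorSubMatrix L M β (bgmFatMultiplier L M klE0 β (nambuXiCT L μ K) (d * k - 1))) X Y‖ ≤ α)
    (hcol : ∀ Y, ∑ X, ‖((sectorSubMatrix L M β (bgmFatMultiplier L M klE0 β (nambuXiCT L μ K) (d * k - 1))).transpose *
        hubbardCovSliceCT L M β μ 0 K (klScale klE0 (d * (k + 1))) (klScale klE0 (d * k)) *
          sectorSubMatrix L M β (bgmFatMultiplier L M klE0 β (nambuXiCT L μ K) (d * k - 1))) X Y‖ ≤ α)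
    {ρ : ℝ} (hρ : 0 < ρ)
    {cr cc : ℝ} (hcr0 : 0 ≤ cr) (hcc0 : 0 ≤ cc)
    (hrow' : ∀ X'', ∑ X', ‖(sectorAnalysisMatrix L M β (klAnisoFamily L M β μ K klE0 (d * k)) *
        sectorSubMatrix L M β (bgmFatMultiplier L M klE0 β (nambuXiCT L μ K) (d * k - 1))) X'' X'‖ ≤ cr)
    (hcol' : ∀ X', ∑ X'', ‖(sectorAnalysisMatrix L M β (klAnisoFamily L M β μ K klE0 (d * k)) *
        sectorSubMatrix L M β (bgmFatMultiplier L M klE0 β (nambuXiCT L μ K) (d * k - 1))) X'' X'‖ ≤ cc)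
    {N : ℕ → ℝ} (hN0 : ∀ m, 0 ≤ N m) (hN00 : N 0 = 0)
    {ω : ℕ → ℝ} (hω0 : ∀ c, 0 ≤ ω c) (hω1 : ω 0 ≤ 1) (hωmul : ∀ a b, ω a * ω b ≤ ω (a + b)) (hωanti : ∀ c, ω (c + 1) ≤ ω c)
    (hNB : ∀ m c, (27 : ℝ) ^ c * (imagTimeWeight β M * klTowerMeasLev L M β U μ K d k (2 * m) (c + 1)) ≤ ω c * N m)
    {D : ℕ} (hD : Fintype.card (SpaceTimeIdx L M × SectorLeg (sectorCount (d * k - 1))) / 2 ≤ D)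
    (q : ℕ) {Nk : ℕ} (hNk : 1 ≤ Nk) {Kt : ℕ} (hKt : (1 / 2 : ℝ) ^ Kt ≤ ω (2 * q + 1))
    {τ ψ : ℝ} (hτ1 : (exp 3 * κ) ^ 2 ≤ τ) (hτ2 : (exp 2 * (κ + ρ)) ^ 2 ≤ τ) (hψ1 : κ⁻¹ ^ 2 ≤ ψ) (hψ2 : ρ⁻¹ ^ 2 ≤ ψ)
    (hguard2 : 2 * (exp 1 * α / κ ^ 2) * towerV D τ N < 1) (F : ℕ) :
    klTowerBornLev L M β U μ K d k (2 * (q + 1)) F ≤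
      ω (F - 1) * (imagTimeWeight β M ^ (2 * q + 1) *
        (cr * cc ^ (2 * q + 1) *
            (∑ n ∈ Icc 2 Nk, exp 1 * (2 * (exp 1 * α / κ ^ 2)) ^ (n - 1) * ψ ^ (q + 1) * towerS D τ N n (q + 1) +
              ψ ^ (q + 1) * (exp 1 * towerV D τ N * (2 * (exp 1 * α / κ ^ 2) * towerV D τ N) ^ Nk /
                (1 - 2 * (exp 1 * α / κ ^ 2) * towerV D τ N))) +
          cr * cc ^ (2 * q + 1) * (exp 2 ^ (q + 2) / 2 * towerFO D (κ ^ 2) N (q + 1)))) := by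
  have hε : 0 ≤ imagTimeWeight β M := imagTimeWeight_nonneg hβ.le M
  have hτ0 : 0 ≤ τ := le_trans (by positivity) hτ1
  have hψ0 : 0 ≤ ψ := le_trans (by positivity) hψ1
  have hΦ0 : 0 ≤ exp 1 * α / κ ^ 2 := by positivity
  have hV0 : 0 ≤ towerV D τ N := towerV_nonneg hτ0 hN0
  have hRHS : 0 ≤ ω (F - 1) * (imagTimeWeight β M ^ (2 * q + 1) *
      (cr * cc ^ (2 * q + 1) *
          (∑ n ∈ Icc 2 Nk, exp 1 * (2 * (exp 1 * α / κ ^ 2)) ^ (n - 1) * ψ ^ (q + 1) * towerS D τ N n (q + 1) +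
            ψ ^ (q + 1) * (exp 1 * towerV D τ N * (2 * (exp 1 * α / κ ^ 2) * towerV D τ N) ^ Nk /
              (1 - 2 * (exp 1 * α / κ ^ 2) * towerV D τ N))) +
        cr * cc ^ (2 * q + 1) * (exp 2 ^ (q + 2) / 2 * towerFO D (κ ^ 2) N (q + 1)))) := by
    have hFO0 : 0 ≤ towerFO D (κ ^ 2) N (q + 1) := towerFO_nonneg (by positivity) hN0 _
    have hS0 : 0 ≤ ∑ n ∈ Icc 2 Nk, exp 1 * (2 * (exp 1 * α / κ ^ 2)) ^ (n - 1) * ψ ^ (q + 1) * towerS D τ N n (q + 1) :=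
      sum_nonneg fun n _ => by have := towerS_nonneg (D := D) hτ0 hN0 n (q + 1); positivity
    have hT0 : 0 ≤ ψ ^ (q + 1) * (exp 1 * towerV D τ N * (2 * (exp 1 * α / κ ^ 2) * towerV D τ N) ^ Nk /
        (1 - 2 * (exp 1 * α / κ ^ 2) * towerV D τ N)) :=
      mul_nonneg (pow_nonneg hψ0 _) (div_nonneg (by positivity) (sub_nonneg.2 hguard2.le))
    have hω := hω0 (F - 1)
    positivity
  unfold klTowerBornLev
  rcases isEmpty_or_nonempty {Ωe : Fin (2 * (q + 1)) → Option (SectorLeg (sectorCount (d * k))) // levelCount Ωe = F} with h | h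
  · rw [Real.iSup_of_isEmpty]; exact hRHS
  · refine ciSup_le fun Ωe => ?_
    have hF : levelCount Ωe.1 = F := Ωe.2
    refine (klLevNormOf_klTowerIncr_le_kit_graded_succ (L := L) (M := M) hβ U μ K hd hk le_rfl hZ hκ hGB hα hrow hcol hρ hcr0 hcc0 hrow' hcol' hN0 hN00
      hω0 hω1 hωmul hωanti hNB hD q hNk hKt hτ1 hτ2 hψ1 hψ2 hguard2 Ωe.1).trans_eq ?_
    rw [hF]


/-! ## §3 Literal kit shape and the output-unit division -/

/-- **Literal kit shape** of `klTowerBornLev_le_kit_graded_succ`: `cr′ = e⁴/2·cr`, `cc′ = e²·cc` absorb the first-order constant (`kitBrackets_explicitFO_le_literal`). -/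
theorem klTowerBornLev_le_kit_graded_succ' {β : ℝ} (hβ : 0 < β) (U μ : ℝ) (K : TrigPolyC4v) {d k : ℕ} (hd : 1 ≤ d) (hk : 1 ≤ k)
    (hZ : hubbardEffPartitionFnCT L M β U μ 0 K (klScale klE0 (d * k)) ≠ 0)
    {κ : ℝ} (hκ : 0 < κ)
    (hGB : IsGramBoundedR ((sectorSubMatrix L M β (bgmFatMultiplier L M klE0 β (nambuXiCT L μ K) (d * k - 1))).transpose *
      hubbardCovSliceCT L M β μ 0 K (klScale klE0 (d * (k + 1))) (klScale klE0 (d * k)) *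
        sectorSubMatrix L M β (bgmFatMultiplier L M klE0 β (nambuXiCT L μ K) (d * k - 1))) κ)
    {α : ℝ} (hα : 0 < α)
    (hrow : ∀ X, ∑ Y, ‖((sectorSubMatrix L M β (bgmFatMultiplier L M klE0 β (nambuXiCT L μ K) (d * k - 1))).transpose *
        hubbardCovSliceCT L M β μ 0 K (klScale klE0 (d * (k + 1))) (klScale klE0 (d * k)) *
          sectorSubMatrix L M β (bgmFatMultiplier L M klE0 β (nambuXiCT L μ K) (d * k - 1))) X Y‖ ≤ α)
    (hcol : ∀ Y, ∑ X, ‖((sectorSubMatrix L M β (bgmFatMultiplier L M klE0 β (nambuXiCT L μ K) (d * k - 1))).transpose *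
        hubbardCovSliceCT L M β μ 0 K (klScale klE0 (d * (k + 1))) (klScale klE0 (d * k)) *
          sectorSubMatrix L M β (bgmFatMultiplier L M klE0 β (nambuXiCT L μ K) (d * k - 1))) X Y‖ ≤ α)
    {ρ : ℝ} (hρ : 0 < ρ)
    {cr cc : ℝ} (hcr0 : 0 ≤ cr) (hcc0 : 0 ≤ cc)
    (hrow' : ∀ X'', ∑ X', ‖(sectorAnalysisMatrix L M β (klAnisoFamily L M β μ K klE0 (d * k)) *
        sectorSubMatrix L M β (bgmFatMultiplier L M klE0 β (nambuXiCT L μ K) (d * k - 1))) X'' X'‖ ≤ cr)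
    (hcol' : ∀ X', ∑ X'', ‖(sectorAnalysisMatrix L M β (klAnisoFamily L M β μ K klE0 (d * k)) *
        sectorSubMatrix L M β (bgmFatMultiplier L M klE0 β (nambuXiCT L μ K) (d * k - 1))) X'' X'‖ ≤ cc)
    {N : ℕ → ℝ} (hN0 : ∀ m, 0 ≤ N m) (hN00 : N 0 = 0)
    {ω : ℕ → ℝ} (hω0 : ∀ c, 0 ≤ ω c) (hω1 : ω 0 ≤ 1) (hωmul : ∀ a b, ω a * ω b ≤ ω (a + b)) (hωanti : ∀ c, ω (c + 1) ≤ ω c)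
    (hNB : ∀ m c, (27 : ℝ) ^ c * (imagTimeWeight β M * klTowerMeasLev L M β U μ K d k (2 * m) (c + 1)) ≤ ω c * N m)
    {D : ℕ} (hD : Fintype.card (SpaceTimeIdx L M × SectorLeg (sectorCount (d * k - 1))) / 2 ≤ D)
    (q : ℕ) {Nk : ℕ} (hNk : 1 ≤ Nk) {Kt : ℕ} (hKt : (1 / 2 : ℝ) ^ Kt ≤ ω (2 * q + 1))
    {τ ψ : ℝ} (hτ1 : (exp 3 * κ) ^ 2 ≤ τ) (hτ2 : (exp 2 * (κ + ρ)) ^ 2 ≤ τ) (hψ1 : κ⁻¹ ^ 2 ≤ ψ) (hψ2 : ρ⁻¹ ^ 2 ≤ ψ)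
    (hguard2 : 2 * (exp 1 * α / κ ^ 2) * towerV D τ N < 1) (F : ℕ) :
    klTowerBornLev L M β U μ K d k (2 * (q + 1)) F ≤
      ω (F - 1) * (imagTimeWeight β M ^ (2 * q + 1) *
        ((exp 4 / 2 * cr) * (exp 2 * cc) ^ (2 * q + 1) *
          (towerFO D (κ ^ 2) N (q + 1) +
            ∑ n ∈ Icc 2 Nk, exp 1 * (2 * (exp 1 * α / κ ^ 2)) ^ (n - 1) * ψ ^ (q + 1) * towerS D τ N n (q + 1) +
            ψ ^ (q + 1) * (exp 1 * towerV D τ N * (2 * (exp 1 * α / κ ^ 2) * towerV D τ N) ^ Nk /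
              (1 - 2 * (exp 1 * α / κ ^ 2) * towerV D τ N))))) := by
  have hε : 0 ≤ imagTimeWeight β M := imagTimeWeight_nonneg hβ.le M
  have hmain := klTowerBornLev_le_kit_graded_succ (L := L) (M := M) hβ U μ K hd hk hZ hκ hGB hα hrow hcol hρ hcr0 hcc0 hrow' hcol' hN0 hN00
    hω0 hω1 hωmul hωanti hNB hD q hNk hKt hτ1 hτ2 hψ1 hψ2 hguard2 F
  refine hmain.trans (mul_le_mul_of_nonneg_left (mul_le_mul_of_nonneg_left ?_ (pow_nonneg hε _)) (hω0 _))
  have hτ0 : 0 ≤ τ := le_trans (by positivity) hτ1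
  have hψ0 : 0 ≤ ψ := le_trans (by positivity) hψ1
  have hΦ0 : 0 ≤ exp 1 * α / κ ^ 2 := by positivity
  have hV0 : 0 ≤ towerV D τ N := towerV_nonneg hτ0 hN0
  have hFO0 : 0 ≤ towerFO D (κ ^ 2) N (q + 1) := towerFO_nonneg (by positivity) hN0 _
  have hS0 : 0 ≤ ∑ n ∈ Icc 2 Nk, exp 1 * (2 * (exp 1 * α / κ ^ 2)) ^ (n - 1) * ψ ^ (q + 1) * towerS D τ N n (q + 1) :=
    sum_nonneg fun n _ => by have := towerS_nonneg (D := D) hτ0 hN0 n (q + 1); positivity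
  have hT0 : 0 ≤ ψ ^ (q + 1) * (exp 1 * towerV D τ N * (2 * (exp 1 * α / κ ^ 2) * towerV D τ N) ^ Nk /
      (1 - 2 * (exp 1 * α / κ ^ 2) * towerV D τ N)) :=
    mul_nonneg (pow_nonneg hψ0 _) (div_nonneg (by positivity) (sub_nonneg.2 hguard2.le))
  exact kitBrackets_explicitFO_le_literal hcr0 hcc0 hFO0 hS0 hT0 q

/-- **THE GRADED ROW DIVIDED BY AN OUTPUT UNIT `(u, Kc)`** (any `u, Kc > 0`): graded majorant in product form `27^c·ε·MeasLev(2m, c) ≤ ω c·((ε·Kc)·(u^m·μ m))`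
with a DIMENSIONLESS `μ ≥ 0`, `μ 0 = 0`; the level-`F` born array lands in the unit `ω(F−1)·(ε·Kc)·u^{q+1}` — i.e. in ITS OWN TRACK's units when
`ω c = 2^{−e*(c+1)J}` — with the kit right side in the dimensionless parameters `Φ̂ = 2·(eα/κ²)·(ε·Kc)`, `ψ̂ = ψ/u`, `τ·u`, `κ²·u`. -/
theorem klTowerBornLev_le_kit_graded_succ_units {β : ℝ} (hβ : 0 < β) (U μ : ℝ) (K : TrigPolyC4v) {d k : ℕ} (hd : 1 ≤ d) (hk : 1 ≤ k)
    (hZ : hubbardEffPartitionFnCT L M β U μ 0 K (klScale klE0 (d * k)) ≠ 0)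
    {κ : ℝ} (hκ : 0 < κ)
    (hGB : IsGramBoundedR ((sectorSubMatrix L M β (bgmFatMultiplier L M klE0 β (nambuXiCT L μ K) (d * k - 1))).transpose *
      hubbardCovSliceCT L M β μ 0 K (klScale klE0 (d * (k + 1))) (klScale klE0 (d * k)) *
        sectorSubMatrix L M β (bgmFatMultiplier L M klE0 β (nambuXiCT L μ K) (d * k - 1))) κ)
    {α : ℝ} (hα : 0 < α)
    (hrow : ∀ X, ∑ Y, ‖((sectorSubMatrix L M β (bgmFatMultiplier L M klE0 β (nambuXiCT L μ K) (d * k - 1))).transpose *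
        hubbardCovSliceCT L M β μ 0 K (klScale klE0 (d * (k + 1))) (klScale klE0 (d * k)) *
          sectorSubMatrix L M β (bgmFatMultiplier L M klE0 β (nambuXiCT L μ K) (d * k - 1))) X Y‖ ≤ α)
    (hcol : ∀ Y, ∑ X, ‖((sectorSubMatrix L M β (bgmFatMultiplier L M klE0 β (nambuXiCT L μ K) (d * k - 1))).transpose *
        hubbardCovSliceCT L M β μ 0 K (klScale klE0 (d * (k + 1))) (klScale klE0 (d * k)) *
          sectorSubMatrix L M β (bgmFatMultiplier L M klE0 β (nambuXiCT L μ K) (d * k - 1))) X Y‖ ≤ α)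
    {ρ : ℝ} (hρ : 0 < ρ)
    {cr cc : ℝ} (hcr0 : 0 ≤ cr) (hcc0 : 0 ≤ cc)
    (hrow' : ∀ X'', ∑ X', ‖(sectorAnalysisMatrix L M β (klAnisoFamily L M β μ K klE0 (d * k)) *
        sectorSubMatrix L M β (bgmFatMultiplier L M klE0 β (nambuXiCT L μ K) (d * k - 1))) X'' X'‖ ≤ cr)
    (hcol' : ∀ X', ∑ X'', ‖(sectorAnalysisMatrix L M β (klAnisoFamily L M β μ K klE0 (d * k)) *
        sectorSubMatrix L M β (bgmFatMultiplier L M klE0 β (nambuXiCT L μ K) (d * k - 1))) X'' X'‖ ≤ cc)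
    {u Kc : ℝ} (hu : 0 < u) (hKc : 0 < Kc) {μd : ℕ → ℝ} (hμ0 : ∀ m, 0 ≤ μd m) (hμ00 : μd 0 = 0)
    {ω : ℕ → ℝ} (hω0 : ∀ c, 0 ≤ ω c) (hω1 : ω 0 ≤ 1) (hωmul : ∀ a b, ω a * ω b ≤ ω (a + b)) (hωanti : ∀ c, ω (c + 1) ≤ ω c)
    (hNB : ∀ m c, (27 : ℝ) ^ c * (imagTimeWeight β M * klTowerMeasLev L M β U μ K d k (2 * m) (c + 1)) ≤
      ω c * ((imagTimeWeight β M * Kc) * (u ^ m * μd m)))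
    {D : ℕ} (hD : Fintype.card (SpaceTimeIdx L M × SectorLeg (sectorCount (d * k - 1))) / 2 ≤ D)
    (q : ℕ) {Nk : ℕ} (hNk : 1 ≤ Nk) {Kt : ℕ} (hKt : (1 / 2 : ℝ) ^ Kt ≤ ω (2 * q + 1))
    {τ ψ : ℝ} (hτ1 : (exp 3 * κ) ^ 2 ≤ τ) (hτ2 : (exp 2 * (κ + ρ)) ^ 2 ≤ τ) (hψ1 : κ⁻¹ ^ 2 ≤ ψ) (hψ2 : ρ⁻¹ ^ 2 ≤ ψ)
    (hguard2 : 2 * (exp 1 * α / κ ^ 2 * (imagTimeWeight β M * Kc)) * towerV D (τ * u) μd < 1) (F : ℕ) :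
    klTowerBornLev L M β U μ K d k (2 * (q + 1)) F ≤
      ω (F - 1) * ((imagTimeWeight β M * (exp 4 / 2 * cr)) * (imagTimeWeight β M * (exp 2 * cc)) ^ (2 * q + 1) * (u ^ (q + 1) * Kc) *
        (towerFO D (κ ^ 2 * u) μd (q + 1) +
          ∑ n ∈ Icc 2 Nk, exp 1 * (2 * (exp 1 * α / κ ^ 2 * (imagTimeWeight β M * Kc))) ^ (n - 1) * (ψ / u) ^ (q + 1) *
            towerS D (τ * u) μd n (q + 1) +
          (ψ / u) ^ (q + 1) * exp 1 * towerV D (τ * u) μd * (2 * (exp 1 * α / κ ^ 2 * (imagTimeWeight β M * Kc)) * towerV D (τ * u) μd) ^ Nk /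
            (1 - 2 * (exp 1 * α / κ ^ 2 * (imagTimeWeight β M * Kc)) * towerV D (τ * u) μd))) := by
  have hε : 0 < imagTimeWeight β M := imagTimeWeight_pos_of_pos (M := M) hβ
  have hN0 : ∀ m, 0 ≤ (imagTimeWeight β M * Kc) * (u ^ m * μd m) := fun m => by have := hμ0 m; positivity
  have hN00 : (imagTimeWeight β M * Kc) * (u ^ 0 * μd 0) = 0 := by rw [hμ00]; ring
  have hV : towerV D τ (fun m => (imagTimeWeight β M * Kc) * (u ^ m * μd m)) = (imagTimeWeight β M * Kc) * towerV D (τ * u) μd :=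
    towerV_units D τ _ u μd
  have hguard' : 2 * (exp 1 * α / κ ^ 2) * towerV D τ (fun m => (imagTimeWeight β M * Kc) * (u ^ m * μd m)) < 1 := by
    rw [hV]; calc 2 * (exp 1 * α / κ ^ 2) * (imagTimeWeight β M * Kc * towerV D (τ * u) μd)
        = 2 * (exp 1 * α / κ ^ 2 * (imagTimeWeight β M * Kc)) * towerV D (τ * u) μd := by ring
      _ < 1 := hguard2
  have h := klTowerBornLev_le_kit_graded_succ' (L := L) (M := M) hβ U μ K hd hk hZ hκ hGB hα hrow hcol hρ hcr0 hcc0 hrow' hcol'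
    (N := fun m => (imagTimeWeight β M * Kc) * (u ^ m * μd m)) hN0 hN00 hω0 hω1 hωmul hωanti hNB hD q hNk hKt hτ1 hτ2 hψ1 hψ2 hguard' F
  have hk := kitStep_abs_eq_units_mul (K := imagTimeWeight β M * Kc) (u := u) (mul_ne_zero hε.ne' hKc.ne') hu.ne' D (κ ^ 2) τ
    (2 * (exp 1 * α / κ ^ 2)) ψ μd Nk (q + 1)
  refine h.trans (le_of_eq ?_)
  rw [show ψ ^ (q + 1) * (exp 1 * towerV D τ (fun m => imagTimeWeight β M * Kc * (u ^ m * μd m)) *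
        (2 * (exp 1 * α / κ ^ 2) * towerV D τ (fun m => imagTimeWeight β M * Kc * (u ^ m * μd m))) ^ Nk /
        (1 - 2 * (exp 1 * α / κ ^ 2) * towerV D τ (fun m => imagTimeWeight β M * Kc * (u ^ m * μd m)))) =
      ψ ^ (q + 1) * exp 1 * towerV D τ (fun m => imagTimeWeight β M * Kc * (u ^ m * μd m)) *
        (2 * (exp 1 * α / κ ^ 2) * towerV D τ (fun m => imagTimeWeight β M * Kc * (u ^ m * μd m))) ^ Nk /
        (1 - 2 * (exp 1 * α / κ ^ 2) * towerV D τ (fun m => imagTimeWeight β M * Kc * (u ^ m * μd m))) by ring, hk]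
  ring


end Summit.HubbardSuperconductivity.HubbardSuperconductivity.Theorems.EngineV8

end
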